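import Summits.QuantumAdvantage.AdviceFreeQNC0.SymmetricOptima
import Summits.QuantumAdvantage.AdviceFreeQNC0.SymmetricDistances
import HarnessLib

/-!
# Cell qa-qnc0 (rung F-Q1, density axis): UNIQUENESS OF THE OPTIMA of `C_8`, `C_9`, `C_15` among ALL codewords, and the
# planner's rungs `SCMarginNine`, `MinWordIsOptDiffEight` (L30 (i), (ii); ROUND-12 (xi-w))

With the orbit-counting engine the statement "`failCount X ≤ w(m,1)` forces the parameter class of `X`" is again a finite
check (`uniqSliceB`: every class has `failCount ≥ w + 1` unless it is a listed exception), and a full block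
(`bs S0 S1 (e0,e1) = m`) pins down the coordinate sets (`sets_of_bs_full`).  Results (kernel, `decide +kernel` slices):

* **`opt_eight`**: an optimal codeword of `C_8` (failCount `≤ 45`) IS `symWord 8 true = (1, ¬par, par)` or
  `symWordB 8 = (par, ¬par, 1)` — no symmetry hypothesis needed; **`opt_nine`**: an optimal codeword of `C_9` IS
  `symWord 9 true`; **`opt_fifteen`**: an optimal codeword of `C_15` IS `symWord 15 false` (the optimum is UNIQUE at odd m,
  as the planner observed: ROUND-12 (xi-k));
* **`scMarginNine : SCMarginNine`** (planner L30 (i)) from `scMargin_nine` and `opt_nine`;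
* **`minWordIsOptDiffEight : MinWordIsOptDiffEight`** (planner L30 (ii)): the two optima of `C_8` differ by a word of weight
  `58` (`pwt_diffEight`, direct evaluation) `= d(C_8)` (`minWt_eight`).

WHAT THIS IS NOT: nothing on MI / MULT₁; separation NOT moved.
-/

namespace Summit.QuantumAdvantage.AdviceFreeQNC0

open Finset

namespace SymCount

open Summit.QuantumAdvantage.AdviceFreeQNC0.MassInequality

variable {m : ℕ}

/-! ### From a full block to the coordinate sets -/

/-- `∅` or `univ`. -/
def setOf (m : ℕ) (e : Bool) : Finset (Fin m) := if e then univ else ∅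

/-- If one block has all `m` coordinates, the coordinate sets are `∅`/`univ` accordingly. -/
theorem sets_of_bs_full {S0 S1 : Finset (Fin m)} {e0 e1 : Bool} (h : bs S0 S1 (e0, e1) = m) :
    S0 = setOf m e0 ∧ S1 = setOf m e1 := by
  classical
  have hall : ∀ i, lab S0 S1 i = (e0, e1) := by
    have hu : block S0 S1 (e0, e1) = univ :=
      Finset.eq_univ_of_card _ (by rw [Fintype.card_fin]; exact h)
    intro i
    have hi : i ∈ block S0 S1 (e0, e1) := hu ▸ mem_univ i
    exact (mem_filter.1 hi).2
  unfold lab at hall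
  simp only [Prod.mk.injEq] at hall
  constructor
  · ext i
    have := (hall i).1
    unfold setOf
    cases e0 <;> simp_all
  · ext i
    have := (hall i).2
    unfold setOf
    cases e1 <;> simp_all

/-! ### Uniqueness of the optimum from Boolean slices -/

/-- "failCount `≥ w + 1`, or a listed exception". -/
def okUniq (w v : ℕ) (exc : Bool) : Bool := Nat.ble (w + 1) v || exc

/-- One `p`-slice of the uniqueness check. -/
def uniqSliceB (m w : ℕ) (exc : ℕ → ℕ → ℕ → ℕ → Bool → Bool → Bool) (p : ℕ) : Bool :=
  allTo (m + 1 - p) fun q => allTo (m + 1 - p - q) fun r =>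
    okUniq w (G4r p q r (m - p - q - r) fun k => !cwVal false false k) (exc p q r (m - p - q - r) false false) &&
    okUniq w (G4r p q r (m - p - q - r) fun k => !cwVal false true k) (exc p q r (m - p - q - r) false true) &&
    okUniq w (G4r p q r (m - p - q - r) fun k => !cwVal true false k) (exc p q r (m - p - q - r) true false) &&
    okUniq w (G4r p q r (m - p - q - r) fun k => !cwVal true true k) (exc p q r (m - p - q - r) true true)

/-- `okUniq` with a value `≤ w` forces the exception. -/
theorem okUniq_spec {w v : ℕ} {exc : Bool} (h : okUniq w v exc = true) (hv : v ≤ w) : exc = true := by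
  unfold okUniq at h
  rw [Bool.or_eq_true, Nat.ble_eq] at h
  exact h.resolve_left (by omega)

/-- **Uniqueness from the slices**: a codeword with `failCount ≤ w` lies in an exceptional parameter class. -/
theorem exc_of_uniqSlices {m w : ℕ} {exc : ℕ → ℕ → ℕ → ℕ → Bool → Bool → Bool}
    (h : ∀ p ≤ m, uniqSliceB m w exc p = true) {X : (Fin m → Bool) → Bool} (hX : IsElim1 m X)
    (hw : failCount X ≤ w) :
    ∃ S0 S1 : Finset (Fin m), ∃ a0 a1 : Bool, X = cwOf (S0, a0) (S1, a1) ∧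
      exc (bs S0 S1 (true, true)) (bs S0 S1 (true, false)) (bs S0 S1 (false, true)) (bs S0 S1 (false, false)) a0 a1
        = true := by
  obtain ⟨⟨S0, a0⟩, ⟨S1, a1⟩, rfl⟩ := exists_cwOf hX
  refine ⟨S0, S1, a0, a1, rfl, ?_⟩
  rw [failCount_cwOf, ← G4q_eq, ← G4r_eq] at hw
  have hs := bs_sum S0 S1
  have h1 := allTo_spec (h (bs S0 S1 (true, true)) (by omega)) (bs S0 S1 (true, false)) (by omega)
  have h2 := allTo_spec h1 (bs S0 S1 (false, true)) (by omega)
  simp only [Bool.and_eq_true] at h2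
  rw [show m - bs S0 S1 (true, true) - bs S0 S1 (true, false) - bs S0 S1 (false, true) =
    bs S0 S1 (false, false) by omega] at h2
  obtain ⟨⟨⟨hff, hft⟩, htf⟩, htt⟩ := h2
  cases a0 <;> cases a1
  · exact okUniq_spec hff hw
  · exact okUniq_spec hft hw
  · exact okUniq_spec htf hw
  · exact okUniq_spec htt hw

/-- The second optimum of `C_8`: `(T₀, T₁, T₂) = (parity, ¬parity, 1)`. -/
def symWordB (m : ℕ) : (Fin m → Bool) → Bool :=
  cwOf ((univ : Finset (Fin m)), false) ((univ : Finset (Fin m)), true)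

/-- Exceptions at `m = 8`: `(S0, S1, α0, α1) = (∅, univ, 1, 1)` or `(univ, univ, 0, 1)`. -/
def exc8 (p q r s : ℕ) (a0 a1 : Bool) : Bool :=
  (Nat.beq p 0 && Nat.beq q 0 && Nat.beq r 8 && Nat.beq s 0 && a0 && a1) ||
    (Nat.beq p 8 && Nat.beq q 0 && Nat.beq r 0 && Nat.beq s 0 && !a0 && a1)

/-- Exception at `m = 9`: `(∅, univ, 1, 1)`. -/
def exc9 (p q r s : ℕ) (a0 a1 : Bool) : Bool :=
  Nat.beq p 0 && Nat.beq q 0 && Nat.beq r 9 && Nat.beq s 0 && a0 && a1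

/-- Exception at `m = 15`: `(∅, univ, 1, 0)`. -/
def exc15 (p q r s : ℕ) (a0 a1 : Bool) : Bool :=
  Nat.beq p 0 && Nat.beq q 0 && Nat.beq r 15 && Nat.beq s 0 && a0 && !a1

/-! ### Uniqueness slices at m = 8 -/

/-- Slice `p = 0` of the uniqueness check at `m = 8`. -/
theorem uniqSlice8_0 : uniqSliceB 8 45 exc8 0 = true := by decide +kernel
/-- Slice `p = 1` of the uniqueness check at `m = 8`. -/
theorem uniqSlice8_1 : uniqSliceB 8 45 exc8 1 = true := by decide +kernel
/-- Slice `p = 2` of the uniqueness check at `m = 8`. -/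
theorem uniqSlice8_2 : uniqSliceB 8 45 exc8 2 = true := by decide +kernel
/-- Slice `p = 3` of the uniqueness check at `m = 8`. -/
theorem uniqSlice8_3 : uniqSliceB 8 45 exc8 3 = true := by decide +kernel
/-- Slice `p = 4` of the uniqueness check at `m = 8`. -/
theorem uniqSlice8_4 : uniqSliceB 8 45 exc8 4 = true := by decide +kernel
/-- Slice `p = 5` of the uniqueness check at `m = 8`. -/
theorem uniqSlice8_5 : uniqSliceB 8 45 exc8 5 = true := by decide +kernel
/-- Slice `p = 6` of the uniqueness check at `m = 8`. -/
theorem uniqSlice8_6 : uniqSliceB 8 45 exc8 6 = true := by decide +kernel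
/-- Slice `p = 7` of the uniqueness check at `m = 8`. -/
theorem uniqSlice8_7 : uniqSliceB 8 45 exc8 7 = true := by decide +kernel
/-- Slice `p = 8` of the uniqueness check at `m = 8`. -/
theorem uniqSlice8_8 : uniqSliceB 8 45 exc8 8 = true := by decide +kernel

/-- All slices at `m = 8`. -/
theorem uniqSlices8 : ∀ p ≤ 8, uniqSliceB 8 45 exc8 p = true := by
  intro p hp
  interval_cases p
  · exact uniqSlice8_0
  · exact uniqSlice8_1
  · exact uniqSlice8_2
  · exact uniqSlice8_3
  · exact uniqSlice8_4
  · exact uniqSlice8_5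
  · exact uniqSlice8_6
  · exact uniqSlice8_7
  · exact uniqSlice8_8

/-! ### Uniqueness slices at m = 9 -/

/-- Slice `p = 0` of the uniqueness check at `m = 9`. -/
theorem uniqSlice9_0 : uniqSliceB 9 90 exc9 0 = true := by decide +kernel
/-- Slice `p = 1` of the uniqueness check at `m = 9`. -/
theorem uniqSlice9_1 : uniqSliceB 9 90 exc9 1 = true := by decide +kernel
/-- Slice `p = 2` of the uniqueness check at `m = 9`. -/
theorem uniqSlice9_2 : uniqSliceB 9 90 exc9 2 = true := by decide +kernel
/-- Slice `p = 3` of the uniqueness check at `m = 9`. -/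
theorem uniqSlice9_3 : uniqSliceB 9 90 exc9 3 = true := by decide +kernel
/-- Slice `p = 4` of the uniqueness check at `m = 9`. -/
theorem uniqSlice9_4 : uniqSliceB 9 90 exc9 4 = true := by decide +kernel
/-- Slice `p = 5` of the uniqueness check at `m = 9`. -/
theorem uniqSlice9_5 : uniqSliceB 9 90 exc9 5 = true := by decide +kernel
/-- Slice `p = 6` of the uniqueness check at `m = 9`. -/
theorem uniqSlice9_6 : uniqSliceB 9 90 exc9 6 = true := by decide +kernel
/-- Slice `p = 7` of the uniqueness check at `m = 9`. -/
theorem uniqSlice9_7 : uniqSliceB 9 90 exc9 7 = true := by decide +kernel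
/-- Slice `p = 8` of the uniqueness check at `m = 9`. -/
theorem uniqSlice9_8 : uniqSliceB 9 90 exc9 8 = true := by decide +kernel
/-- Slice `p = 9` of the uniqueness check at `m = 9`. -/
theorem uniqSlice9_9 : uniqSliceB 9 90 exc9 9 = true := by decide +kernel

/-- All slices at `m = 9`. -/
theorem uniqSlices9 : ∀ p ≤ 9, uniqSliceB 9 90 exc9 p = true := by
  intro p hp
  interval_cases p
  · exact uniqSlice9_0
  · exact uniqSlice9_1
  · exact uniqSlice9_2
  · exact uniqSlice9_3
  · exact uniqSlice9_4
  · exact uniqSlice9_5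
  · exact uniqSlice9_6
  · exact uniqSlice9_7
  · exact uniqSlice9_8
  · exact uniqSlice9_9

/-! ### Uniqueness slices at m = 15 -/

/-- Slice `p = 0` of the uniqueness check at `m = 15`. -/
theorem uniqSlice15_0 : uniqSliceB 15 8736 exc15 0 = true := by decide +kernel
/-- Slice `p = 1` of the uniqueness check at `m = 15`. -/
theorem uniqSlice15_1 : uniqSliceB 15 8736 exc15 1 = true := by decide +kernel
/-- Slice `p = 2` of the uniqueness check at `m = 15`. -/
theorem uniqSlice15_2 : uniqSliceB 15 8736 exc15 2 = true := by decide +kernel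
/-- Slice `p = 3` of the uniqueness check at `m = 15`. -/
theorem uniqSlice15_3 : uniqSliceB 15 8736 exc15 3 = true := by decide +kernel
/-- Slice `p = 4` of the uniqueness check at `m = 15`. -/
theorem uniqSlice15_4 : uniqSliceB 15 8736 exc15 4 = true := by decide +kernel
/-- Slice `p = 5` of the uniqueness check at `m = 15`. -/
theorem uniqSlice15_5 : uniqSliceB 15 8736 exc15 5 = true := by decide +kernel
/-- Slice `p = 6` of the uniqueness check at `m = 15`. -/
theorem uniqSlice15_6 : uniqSliceB 15 8736 exc15 6 = true := by decide +kernel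
/-- Slice `p = 7` of the uniqueness check at `m = 15`. -/
theorem uniqSlice15_7 : uniqSliceB 15 8736 exc15 7 = true := by decide +kernel
/-- Slice `p = 8` of the uniqueness check at `m = 15`. -/
theorem uniqSlice15_8 : uniqSliceB 15 8736 exc15 8 = true := by decide +kernel
/-- Slice `p = 9` of the uniqueness check at `m = 15`. -/
theorem uniqSlice15_9 : uniqSliceB 15 8736 exc15 9 = true := by decide +kernel
/-- Slice `p = 10` of the uniqueness check at `m = 15`. -/
theorem uniqSlice15_10 : uniqSliceB 15 8736 exc15 10 = true := by decide +kernel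
/-- Slice `p = 11` of the uniqueness check at `m = 15`. -/
theorem uniqSlice15_11 : uniqSliceB 15 8736 exc15 11 = true := by decide +kernel
/-- Slice `p = 12` of the uniqueness check at `m = 15`. -/
theorem uniqSlice15_12 : uniqSliceB 15 8736 exc15 12 = true := by decide +kernel
/-- Slice `p = 13` of the uniqueness check at `m = 15`. -/
theorem uniqSlice15_13 : uniqSliceB 15 8736 exc15 13 = true := by decide +kernel
/-- Slice `p = 14` of the uniqueness check at `m = 15`. -/
theorem uniqSlice15_14 : uniqSliceB 15 8736 exc15 14 = true := by decide +kernel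
/-- Slice `p = 15` of the uniqueness check at `m = 15`. -/
theorem uniqSlice15_15 : uniqSliceB 15 8736 exc15 15 = true := by decide +kernel

/-- All slices at `m = 15`. -/
theorem uniqSlices15 : ∀ p ≤ 15, uniqSliceB 15 8736 exc15 p = true := by
  intro p hp
  interval_cases p
  · exact uniqSlice15_0
  · exact uniqSlice15_1
  · exact uniqSlice15_2
  · exact uniqSlice15_3
  · exact uniqSlice15_4
  · exact uniqSlice15_5
  · exact uniqSlice15_6
  · exact uniqSlice15_7
  · exact uniqSlice15_8
  · exact uniqSlice15_9
  · exact uniqSlice15_10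
  · exact uniqSlice15_11
  · exact uniqSlice15_12
  · exact uniqSlice15_13
  · exact uniqSlice15_14
  · exact uniqSlice15_15

/-! ### The optima, by name -/

/-- **The optimal codewords of `C_8` are exactly `symWord 8 true` and `symWordB 8`.** -/
theorem opt_eight {K0 : (Fin 8 → Bool) → Bool} (hK : IsOpt1 8 K0) : K0 = symWord 8 true ∨ K0 = symWordB 8 := by
  have hle : failCount K0 ≤ 45 := by
    have := hK.2 _ (isElim1_symWord 8 true); rwa [failCount_symWord_eight] at this
  obtain ⟨S0, S1, a0, a1, rfl, hexc⟩ := exc_of_uniqSlices uniqSlices8 hK.1 hle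
  unfold exc8 at hexc
  simp only [Bool.or_eq_true, Bool.and_eq_true, Nat.beq_eq, Bool.not_eq_true'] at hexc
  rcases hexc with ⟨⟨⟨⟨⟨_, _⟩, hr⟩, _⟩, ha0⟩, ha1⟩ | ⟨⟨⟨⟨⟨hp, _⟩, _⟩, _⟩, ha0⟩, ha1⟩
  · obtain ⟨h0, h1⟩ := sets_of_bs_full (e0 := false) (e1 := true) hr
    left; subst ha0; subst ha1; rw [h0, h1]; rfl
  · obtain ⟨h0, h1⟩ := sets_of_bs_full (e0 := true) (e1 := true) hp
    right; subst ha0; subst ha1; rw [h0, h1]; rfl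

/-- **The optimal codeword of `C_9` is `symWord 9 true`** (unique). -/
theorem opt_nine {K0 : (Fin 9 → Bool) → Bool} (hK : IsOpt1 9 K0) : K0 = symWord 9 true := by
  have hle : failCount K0 ≤ 90 := by
    have := hK.2 _ (isElim1_symWord 9 true); rwa [failCount_symWord_nine] at this
  obtain ⟨S0, S1, a0, a1, rfl, hexc⟩ := exc_of_uniqSlices uniqSlices9 hK.1 hle
  unfold exc9 at hexc
  simp only [Bool.and_eq_true, Nat.beq_eq] at hexc
  obtain ⟨⟨⟨⟨⟨_, _⟩, hr⟩, _⟩, ha0⟩, ha1⟩ := hexc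
  obtain ⟨h0, h1⟩ := sets_of_bs_full (e0 := false) (e1 := true) hr
  subst ha0; subst ha1; rw [h0, h1]; rfl

/-- **The optimal codeword of `C_15` is `symWord 15 false`** (unique). -/
theorem opt_fifteen {K0 : (Fin 15 → Bool) → Bool} (hK : IsOpt1 15 K0) : K0 = symWord 15 false := by
  have hle : failCount K0 ≤ 8736 := by
    have := hK.2 _ (isElim1_symWord 15 false); rwa [failCount_symWord_fifteen] at this
  obtain ⟨S0, S1, a0, a1, rfl, hexc⟩ := exc_of_uniqSlices uniqSlices15 hK.1 hle
  unfold exc15 at hexc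
  simp only [Bool.and_eq_true, Nat.beq_eq, Bool.not_eq_true'] at hexc
  obtain ⟨⟨⟨⟨⟨_, _⟩, hr⟩, _⟩, ha0⟩, ha1⟩ := hexc
  obtain ⟨h0, h1⟩ := sets_of_bs_full (e0 := false) (e1 := true) hr
  subst ha0; subst ha1; rw [h0, h1]; rfl

/-! ### The planner's rungs -/

/-- **`SCMarginNine`** (planner L30 (i)): at the (unique) optimum of `C_9` every non-zero codeword has
`|A ∖ Z| ≥ |A ∩ Z| + 40`. -/
theorem scMarginNine : SCMarginNine := by
  intro K0 hK _
  rw [opt_nine hK]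
  exact scMargin_nine

/-- The difference of the two optima of `C_8`. -/
def diffEight : (Fin 8 → Bool) → Bool := fun u => xor (symWord 8 true u) (symWordB 8 u)

/-- Its weight is `58` (direct evaluation on the 256 points). -/
theorem pwt_diffEight : pwt diffEight = 58 := by
  unfold pwt diffEight symWord symWordB cwOf tripleOf sel affEval wt
  decide +kernel

/-- `diffEight` is a minimum-weight word of `C_8`. -/
theorem isMinWord_diffEight : IsMinWord 8 diffEight := by
  refine ⟨isElim1_xor (isElim1_symWord 8 true) (isElim1_cwOf _ _), by rw [pwt_diffEight]; norm_num,
    fun Q hQ hQ0 => ?_⟩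
  rw [pwt_diffEight]
  exact minWt_eight Q hQ hQ0

/-- **`MinWordIsOptDiffEight`** (planner L30 (ii) / ROUND-12 (xi-w)): the sum of two distinct optimal codewords of `C_8`
is a minimum-weight word (both optima are symmetric; there are exactly two). -/
theorem minWordIsOptDiffEight : MinWordIsOptDiffEight := by
  intro K0 K1 hK0 _ hK1 hne
  have hcomm : (fun u => xor (symWordB 8 u) (symWord 8 true u)) = diffEight := by
    funext u; unfold diffEight; exact Bool.xor_comm _ _
  rcases opt_eight hK0 with rfl | rfl <;> rcases opt_eight hK1 with rfl | rfl
  · exact absurd rfl hne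
  · exact isMinWord_diffEight
  · rw [hcomm]; exact isMinWord_diffEight
  · exact absurd rfl hne

end SymCount

end Summit.QuantumAdvantage.AdviceFreeQNC0
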